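import Summits.HodgeConjecture.CorCM.SexticDecicWeilFourfoldParts
import Summits.HodgeConjecture.CorCM.DecicCurveFivefoldWeilAiming
import HarnessLib

/-!
# COR-CM — `E × T × B` over a sextic and a decic CM field sharing `k`: the Weil SIXFOLD parts (a curve point + the five labels of `B` of
# one sign — the Weil weight of the sixfold `B × E`) of the weights of every product of copies have algebraic lines, GIVEN Markman's
# hyperbolic-sixfold theorem

Cell `pub-hodgecm2` (COR-CM), seat b30 gen 27 (2026-08-23); count-neutral own lane SEXTIC-DECIC; sequel of
`CorCM/SexticDecicWeilFourfoldParts.lean`.  Theorems, plus ONE bookkeeping definition (the sub-family `fold₆SD = (2, 0)` of slots: `B ⊞ E`);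
no named fact, no `sorry`.  The Weil plane of the SIXFOLD `(B × E, ι_B(i₃δ) × ι_E(δ))` (`k`-signature `(2,3) + (1,0) = (3,3)`) enters §1–§2
as the HYPOTHESIS `hW₃` (product form), discharged in §3 from `Markman2025_weilClasses_algebraic_hyperbolicSixfold` by seat b09's
`DecicCurveFivefold.weilClassesOf_le_algebraicClasses_cmFivefold_prod_cmCurve_of_markmanSixfold` fed with the type count of the frame reading
(the one-curve twin of gen 22ʼs `DecicWeil23Pair.weightClassesAlg_le_algebraicClasses_of_isSixPartD`).

* §1 `fold₆SD`, `weightClassesAlg_three_le_algebraicClasses_of_signSD` — a six-point weight of `Y = E ⊞ T ⊞ B` on the slots `{2, 0}` of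
  constant sign lies in a Weil eigenline of the sub-product `B ⊞ E` (`PairWeights.weightClassesAlg_le_weilClassesPlus/Minus`), algebraic
  by `hW₃` transported to `⨁` (`PairWeights.weilClassesOf_biproduct_le_algebraicClasses_of_prod`), pulled back;
* §2 **`weightClassesAlg_le_algebraicClasses_of_isSixPartSD`** — ANY slot map `κ : Fin N → Fin 3`;
* §3 `typeCount_sixfold_of_frameSD`, **`weilClassesOf_sixfold_le_algebraicClasses_of_frameSD_of_markmanSixfold`** (`hW₃` from Markman).
HONEST FRAMING: nothing about the Hodge conjecture is concluded here; `HC_CM` is not asserted.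
[cite: Markman2025SecantWeil, Thm 1.5.1] [cite: Deligne1982HodgeCycles, §5 (c)] [cite: vanGeemen1994HodgeAV, 4.9]
[cite: Milne2020HodgeClassesAV, 1.2 (a) and Thm. 1] [cite: MoonenZarhin1995Duke, Thm. 2.4]

## References
* [Markman2025SecantWeil] E. Markman, arXiv:2502.03415 (unrefereed), Thm 1.5.1.  [Deligne1982HodgeCycles] P. Deligne, LNM 900 (1982),
  §5 (c).  [vanGeemen1994HodgeAV] B. van Geemen, LNM 1594 (1994), 3.6–3.7, 4.9.  [Milne2020HodgeClassesAV] J. S. Milne,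
  arXiv:2010.08857, 1.2 (a), Thm. 1.  [MoonenZarhin1995Duke] B. Moonen, Yu. Zarhin, Duke Math. J. 77 (1995), Thm. 2.4.
-/

noncomputable section

open CategoryTheory CategoryTheory.Limits NumberField

namespace Summit.HodgeConjecture.CorCM.SexticDecicWeil

open Literature.AlgebraicGeometry Literature.AlgebraicGeometry.Motives Literature.AlgebraicGeometry.HodgeTheory
open Literature.AlgebraicGeometry.ComplexMultiplication (IsCMTypeRealisation)
open Literature.AlgebraicGeometry.Pohlmann1968
open Literature.AlgebraicTopology.SingularHomology
open Literature.NumberTheory.ComplexMultiplication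
open Summit.HodgeConjecture.CorCM.Census.SexticDecicWeil (PtSD IsFivePartSD IsSixPartSD)
open Summit.HodgeConjecture.CorCM.SexticOcticWeil (soSlots sigma_cases₃ exists_map_sigma_eq₃)
open Summit.HodgeConjecture.CorCM.DihedralSexticPair (card_filter_equiv_mem)
open Summit.HodgeConjecture.CorCM.CMWeights (weightClassesAlg_comp_le_algebraicClasses_of_injOn
  weightClassesAlg_map_le_algebraicClasses sigma_map_injective)
open Summit.HodgeConjecture.CorCM.PairWeights

open scoped Classical

/-! ## §1 Six-point weights of `Y = E ⊞ T ⊞ B` of constant sign on the slots `{2, 0}` -/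

/-- The sub-family `(2, 0)` of slots: `B ⊞ E` (fivefold FIRST, as in seat b09's sixfold `B × E`). [folklore] -/
def fold₆SD : Fin 2 → Fin 3 := Fin.cons 2 fun _ : Fin 1 => 0

/-- `fold₆SD` is injective. [folklore] -/
theorem fold₆SD_injective : Function.Injective fold₆SD := by
  intro p q hpq
  fin_cases p <;> fin_cases q
  · rfl
  · exact absurd hpq (by decide)
  · exact absurd hpq (by decide)
  · rfl

section Six

variable {I : Type} {Kf : I → Type} [∀ i, Field (Kf i)] [∀ i, NumberField (Kf i)]
  {i₀ i₁ i₂ : I} {e₁ : (Kf i₁ →+* ℂ) ≃ Fin 3 × Bool} {e₃ : (Kf i₂ →+* ℂ) ≃ Fin 5 × Bool} {τ : Kf i₀ →+* ℂ}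
  {i₁' : Kf i₀ →+* Kf i₁} {i₃' : Kf i₀ →+* Kf i₂}
  (hk : ∀ σ : Kf i₀ →+* ℂ, σ = τ ∨ σ = ComplexEmbedding.conjugate τ)
  (he₁_sign : ∀ s : Kf i₁ →+* ℂ, (e₁ s).2 = true ↔ s.comp i₁' = τ)
  (he₃_sign : ∀ t : Kf i₂ →+* ℂ, (e₃ t).2 = true ↔ t.comp i₃' = τ)
  {A : Fin 3 → AbelianVariety ℂ} {Φ : ∀ j : Fin 3, CMType (Kf (soSlots i₀ i₁ i₂ j))}
  {ι : ∀ j, 𝓞 (Kf (soSlots i₀ i₁ i₂ j)) →+* End (A j)}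
  {θ : ∀ j, Kf (soSlots i₀ i₁ i₂ j) →+* Module.End ℂ (complexBetti (A j).X 1)}
  (hA : ∀ j, IsCMTypeRealisation (Φ j) (A j) (ι j) (θ j))
  {δ : 𝓞 (Kf i₀)} {d : ℕ} (hτ : τ (δ : Kf i₀) = Complex.I * (Real.sqrt d : ℂ))

include hk he₁_sign he₃_sign hA hτ in
/-- **A six-point weight of `Y = E ⊞ T ⊞ B` of constant sign on the slots `{2, 0}` has an algebraic line, GIVEN the Weil plane of `B × E`.**
All six points have eigenvalue `±i√d` on `(δ; i₁δ, i₃δ)`, so the restriction to the sub-product `B ⊞ E` lies in a Weil eigenline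
(`PairWeights.weightClassesAlg_le_weilClassesPlus/Minus`) `⊆ W ⊗ ℂ`, algebraic by `hW₃` transported to `⨁`; pull back to `Y`.
[cite: vanGeemen1994HodgeAV, 4.9] [cite: Deligne1982HodgeCycles, §5 (c)] [cite: Milne2020HodgeClassesAV, 1.2 (a)] -/
theorem weightClassesAlg_three_le_algebraicClasses_of_signSD
    (hW₃ : weilClassesOf ((A 2).prod (A 0))
      (AbelianVariety.prodLift (AbelianVariety.fst (A 2) (A 0) ≫ ι 2 (RingOfIntegers.mapRingHom i₃' δ))
        (AbelianVariety.snd (A 2) (A 0) ≫ ι 0 δ)) 3 d ≤ algebraicClasses ((A 2).prod (A 0)).X 3)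
    (b : Bool) (T : Finset ((j : Fin 3) × (Kf (soSlots i₀ i₁ i₂ j) →+* ℂ))) (hTcard : T.card = 2 * 3)
    (hsgn : ∀ z ∈ T, toPtSD e₁ e₃ τ z = Sum.inl b ∨ ∃ a : Fin 5, toPtSD e₁ e₃ τ z = Sum.inr (Sum.inr (a, b))) :
    weightClassesAlg A ι (2 * 3) T ≤ algebraicClasses (⨁ A).X 3 := by
  -- every point of `T` is on the slots `2`, `0`
  have hTslot : ∀ x ∈ T, x.1 ∈ Set.range fold₆SD := by
    intro x hx
    rcases sigma_cases₃ x with ⟨σ, rfl⟩ | ⟨s, rfl⟩ | ⟨t, rfl⟩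
    · exact ⟨1, rfl⟩
    · rcases hsgn _ hx with h | ⟨a, h⟩
      · rw [toPtSD_one] at h; exact absurd h Sum.inr_ne_inl
      · rw [toPtSD_one, Sum.inr.injEq] at h; exact absurd h Sum.inl_ne_inr
    · exact ⟨0, rfl⟩
  obtain ⟨S'', hS''T, hS''mem⟩ := exists_map_sigma_eq₃ fold₆SD fold₆SD_injective T hTslot
  have hcardS'' : S''.card = 2 * 3 := by rw [← hS''T, Finset.card_map] at hTcard; exact hTcard
  -- the family `(i₃δ, δ)` on the two slots, as the restriction of `(δ; i₁δ, i₃δ)`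
  let aY : ∀ j : Fin 3, 𝓞 (Kf (soSlots i₀ i₁ i₂ j)) :=
    Fin.cons δ (Fin.cons (RingOfIntegers.mapRingHom i₁' δ) fun _ : Fin 1 => RingOfIntegers.mapRingHom i₃' δ)
  let a' : ∀ j : Fin 2, 𝓞 (Kf (soSlots i₀ i₁ i₂ (fold₆SD j))) := fun j => aY (fold₆SD j)
  have hval : ∀ z ∈ S'', z.2 ((a' z.1 : 𝓞 (Kf (soSlots i₀ i₁ i₂ (fold₆SD z.1)))) : Kf (soSlots i₀ i₁ i₂ (fold₆SD z.1))) =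
      if b then Complex.I * (Real.sqrt d : ℂ) else -(Complex.I * (Real.sqrt d : ℂ)) := by
    intro z hz
    have hx := hsgn _ ((hS''mem z).1 hz)
    exact apply_eq_of_signSD hk he₁_sign he₃_sign hτ ⟨fold₆SD z.1, z.2⟩ b (by
      rcases hx with h | h
      · exact Or.inl h
      · exact Or.inr (Or.inr h))
  -- the Weil plane of `⨁_j A(fold₆SD j) = B ⊞ E`, algebraic by `hW₃`
  have hWeil : weilClassesOf (⨁ fun j => A (fold₆SD j)) (biproduct.map fun j => ι (fold₆SD j) (a' j)) 3 d ≤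
      algebraicClasses (⨁ fun j => A (fold₆SD j)).X 3 :=
    weilClassesOf_biproduct_le_algebraicClasses_of_prod (A := fun j => A (fold₆SD j)) (fun j => ι (fold₆SD j) (a' j)) hW₃
  have halg : weightClassesAlg (K := fun j => Kf (soSlots i₀ i₁ i₂ (fold₆SD j))) (fun j => A (fold₆SD j)) (fun j => ι (fold₆SD j))
      (2 * 3) S'' ≤ algebraicClasses (⨁ fun j => A (fold₆SD j)).X 3 := by
    cases b
    · refine (weightClassesAlg_le_weilClassesMinus (K := fun j => Kf (soSlots i₀ i₁ i₂ (fold₆SD j))) (A := fun j => A (fold₆SD j))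
        (ι := fun j => ι (fold₆SD j)) a' hcardS'' fun z hz => ?_).trans ((weilClassesMinus_le_weilClassesOf _ _ 3 d).trans hWeil)
      simpa using hval z hz
    · refine (weightClassesAlg_le_weilClassesPlus (K := fun j => Kf (soSlots i₀ i₁ i₂ (fold₆SD j))) (A := fun j => A (fold₆SD j))
        (ι := fun j => ι (fold₆SD j)) a' hcardS'' fun z hz => ?_).trans ((weilClassesPlus_le_weilClassesOf _ _ 3 d).trans hWeil)
      simpa using hval z hz
  rw [← hS''T]
  exact weightClassesAlg_map_le_algebraicClasses hA fold₆SD fold₆SD_injective hcardS'' halg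

end Six

/-! ## §2 The six parts of the products of copies -/

section SixX

variable {I : Type} {Kf : I → Type} [∀ i, Field (Kf i)] [∀ i, NumberField (Kf i)]
  {i₀ i₁ i₂ : I} {N : ℕ} (κ : Fin N → Fin 3) {e₁ : (Kf i₁ →+* ℂ) ≃ Fin 3 × Bool} {e₃ : (Kf i₂ →+* ℂ) ≃ Fin 5 × Bool}
  {τ : Kf i₀ →+* ℂ} {i₁' : Kf i₀ →+* Kf i₁} {i₃' : Kf i₀ →+* Kf i₂}
  (hk : ∀ σ : Kf i₀ →+* ℂ, σ = τ ∨ σ = ComplexEmbedding.conjugate τ)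
  (he₁_sign : ∀ s : Kf i₁ →+* ℂ, (e₁ s).2 = true ↔ s.comp i₁' = τ)
  (he₃_sign : ∀ t : Kf i₂ →+* ℂ, (e₃ t).2 = true ↔ t.comp i₃' = τ)
  {A : Fin 3 → AbelianVariety ℂ} {Φ : ∀ j : Fin 3, CMType (Kf (soSlots i₀ i₁ i₂ j))}
  {ι : ∀ j, 𝓞 (Kf (soSlots i₀ i₁ i₂ j)) →+* End (A j)}
  {θ : ∀ j, Kf (soSlots i₀ i₁ i₂ j) →+* Module.End ℂ (complexBetti (A j).X 1)}
  (hA : ∀ j, IsCMTypeRealisation (Φ j) (A j) (ι j) (θ j))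
  {δ : 𝓞 (Kf i₀)} {d : ℕ} (hτ : τ (δ : Kf i₀) = Complex.I * (Real.sqrt d : ℂ))

omit [∀ i, NumberField (Kf i)] in
/-- The model map is injective on a six part (one point over each of its six labels). [folklore] -/
theorem _root_.Summit.HodgeConjecture.CorCM.Census.SexticDecicWeil.IsSixPartSD.injOn {α : Type*} {v : α → PtSD} {b : Bool}
    {G : Finset α} (hG : IsSixPartSD v b G) : Set.InjOn v ↑G := by
  obtain ⟨x, G₁, hxG₁, rfl, hvx, hG₁⟩ := hG.exists_split
  intro z hz z' hz' h
  simp only [Finset.coe_insert, Set.mem_insert_iff, Finset.mem_coe] at hz hz'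
  rcases hz with rfl | hz <;> rcases hz' with rfl | hz'
  · rfl
  · obtain ⟨a, ha⟩ := hG₁.exists_eq hz'
    rw [hvx, ha] at h; exact absurd h Sum.inl_ne_inr
  · obtain ⟨a, ha⟩ := hG₁.exists_eq hz
    rw [hvx, ha] at h; exact absurd h Sum.inr_ne_inl
  · exact hG₁.injOn hz hz' h

include hk he₁_sign he₃_sign hA hτ in
/-- **THE SIX PARTS HAVE ALGEBRAIC LINES (any slot map).**  For `κ : Fin N → Fin 3` and a six part `G` (sign `b`) of a weight of
`X = ⨁_j A(κ j)` — a curve point over `τ_b` and the five labels `(2, a, b)` — `H⁶(X)_G ⊆ N³ H⁶(X)`, GIVEN the Weil plane of `B × E`: the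
part is `v`-injective, its slot projection is a six-point weight of `Y` of constant sign on the slots `{2, 0}` (§1), lifted along `κ`
(distribution lemma). [cite: Milne2020HodgeClassesAV, 1.2 (a) and Thm. 1] [cite: Deligne1982HodgeCycles, §5 (c)] -/
theorem weightClassesAlg_le_algebraicClasses_of_isSixPartSD
    (hW₃ : weilClassesOf ((A 2).prod (A 0))
      (AbelianVariety.prodLift (AbelianVariety.fst (A 2) (A 0) ≫ ι 2 (RingOfIntegers.mapRingHom i₃' δ))
        (AbelianVariety.snd (A 2) (A 0) ≫ ι 0 δ)) 3 d ≤ algebraicClasses ((A 2).prod (A 0)).X 3)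
    {b : Bool} {G : Finset ((j : Fin N) × (Kf (soSlots i₀ i₁ i₂ (κ j)) →+* ℂ))}
    (hG : IsSixPartSD (fun x => toPtSD e₁ e₃ τ ((Sigma.map κ (fun _ => id) :
      ((j : Fin N) × (Kf (soSlots i₀ i₁ i₂ (κ j)) →+* ℂ)) → ((m : Fin 3) × (Kf (soSlots i₀ i₁ i₂ m) →+* ℂ))) x)) b G) :
    G.card = 2 * 3 ∧ weightClassesAlg (fun j => A (κ j)) (fun j => ι (κ j)) (2 * 3) G ≤
      algebraicClasses (⨁ fun j => A (κ j)).X 3 := by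
  have hGcard : G.card = 2 * 3 := by rw [hG.1]
  refine ⟨hGcard, ?_⟩
  set Pm : ((j : Fin N) × (Kf (soSlots i₀ i₁ i₂ (κ j)) →+* ℂ)) → ((m : Fin 3) × (Kf (soSlots i₀ i₁ i₂ m) →+* ℂ)) :=
    Sigma.map κ (fun _ => id) with hPm
  have hinj := hG.injOn
  have hPinj : Set.InjOn Pm ↑G := fun x hx x' hx' h => hinj hx hx' (by
    change toPtSD e₁ e₃ τ (Pm x) = toPtSD e₁ e₃ τ (Pm x'); rw [h])
  set TY : Finset ((m : Fin 3) × (Kf (soSlots i₀ i₁ i₂ m) →+* ℂ)) := G.image Pm with hTY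
  have hTYcard : TY.card = 2 * 3 := by rw [hTY, Finset.card_image_of_injOn hPinj, hGcard]
  have hsgn : ∀ z ∈ TY, toPtSD e₁ e₃ τ z = Sum.inl b ∨ ∃ a : Fin 5, toPtSD e₁ e₃ τ z = Sum.inr (Sum.inr (a, b)) := by
    intro z hz
    obtain ⟨x, hx, rfl⟩ := Finset.mem_image.1 hz
    exact hG.mem_cases hx
  have hYalg := weightClassesAlg_three_le_algebraicClasses_of_signSD hk he₁_sign he₃_sign hA hτ hW₃ b TY hTYcard hsgn
  exact weightClassesAlg_comp_le_algebraicClasses_of_injOn (K := fun m => Kf (soSlots i₀ i₁ i₂ m)) hA κ hGcard hPinj hYalg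

end SixX

/-! ## §3 The Weil plane of `B × E` from Markman's hyperbolic-sixfold theorem -/

section Markman

variable {I : Type} {Kf : I → Type} [∀ i, Field (Kf i)] [∀ i, NumberField (Kf i)] [∀ i, IsCMField (Kf i)]
  {i₀ i₁ i₂ : I} {e₃ : (Kf i₂ →+* ℂ) ≃ Fin 5 × Bool} {τ : Kf i₀ →+* ℂ} {i₃' : Kf i₀ →+* Kf i₂}
  {A : Fin 3 → AbelianVariety ℂ} {Φ : ∀ j : Fin 3, CMType (Kf (soSlots i₀ i₁ i₂ j))}
  {ι : ∀ j, 𝓞 (Kf (soSlots i₀ i₁ i₂ j)) →+* End (A j)}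
  {θ : ∀ j, Kf (soSlots i₀ i₁ i₂ j) →+* Module.End ℂ (complexBetti (A j).X 1)}

/-- **The type count of the fivefold slot against `Ψ = {τ}`**: a `(2,3)`-reading ⟹ `#{t ∈ Φ 2 | t ∘ i₃ = τ'} + [τ' ∈ Ψ] = 3` for every
`τ'` — the Weil-type condition `(3,3)` of the sixfold `B × E`. [cite: Deligne1982HodgeCycles, §5 (c)] -/
theorem typeCount_sixfold_of_frameSD (h2 : Module.finrank ℚ (Kf i₀) = 2)
    (he₃_sign : ∀ t : Kf i₂ →+* ℂ, (e₃ t).2 = true ↔ t.comp i₃' = τ)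
    {Φ₃ : CMType (Kf i₂)} (hΦ₃ : ∀ t : Kf i₂ →+* ℂ, t ∈ Φ₃.1 ↔ (e₃ t).2 = decide ((e₃ t).1 = 0 ∨ (e₃ t).1 = 1))
    {Ψ : CMType (Kf i₀)} (hΨ : ∀ σ : Kf i₀ →+* ℂ, σ ∈ Ψ.1 ↔ σ = τ) (τ' : Kf i₀ →+* ℂ) :
    (Finset.univ.filter fun t : Kf i₂ →+* ℂ => t.comp i₃' = τ' ∧ t ∈ Φ₃.1).card + (if τ' ∈ Ψ.1 then 1 else 0) = 3 := by
  have hττ : ComplexEmbedding.conjugate τ ≠ τ := QuarticCM.conjugate_ne τ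
  have hk : ∀ σ : Kf i₀ →+* ℂ, σ = τ ∨ σ = ComplexEmbedding.conjugate τ := fun σ =>
    QuarticCM.eq_or_eq_conjugate_of_quadratic h2 τ σ
  have hsign : ∀ t : Kf i₂ →+* ℂ, (e₃ t).2 = decide (t.comp i₃' = τ) := fun t => by
    by_cases h : t.comp i₃' = τ
    · rw [decide_eq_true h]; exact (he₃_sign t).2 h
    · rw [decide_eq_false h]
      cases h' : (e₃ t).2
      · rfl
      · exact absurd ((he₃_sign t).1 h') h
  rcases hk τ' with h' | h' <;> rw [h']
  · rw [if_pos ((hΨ _).2 rfl)]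
    have hfilter : (Finset.univ.filter fun t : Kf i₂ →+* ℂ => t.comp i₃' = τ ∧ t ∈ Φ₃.1) =
        Finset.univ.filter fun t => e₃ t ∈ (Finset.univ.filter fun y : Fin 5 × Bool => y.2 = true ∧ y.2 = decide (y.1 = 0 ∨ y.1 = 1)) := by
      refine Finset.filter_congr fun t _ => ?_
      rw [hΦ₃ t, Finset.mem_filter, ← he₃_sign t]
      simp
    rw [hfilter, card_filter_equiv_mem]
    decide
  · have hnot : ComplexEmbedding.conjugate τ ∉ Ψ.1 := fun h => hττ ((hΨ _).1 h)
    rw [if_neg hnot, add_zero]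
    have hneg : ∀ t : Kf i₂ →+* ℂ, t.comp i₃' = ComplexEmbedding.conjugate τ ↔ (e₃ t).2 = false := fun t => by
      rw [hsign]
      rcases hk (t.comp i₃') with h | h
      · rw [h, decide_eq_true rfl]; exact ⟨fun h' => absurd h'.symm hττ, fun h' => absurd h' (by decide)⟩
      · rw [h, decide_eq_false hττ]; exact ⟨fun _ => rfl, fun _ => rfl⟩
    have hfilter : (Finset.univ.filter fun t : Kf i₂ →+* ℂ => t.comp i₃' = ComplexEmbedding.conjugate τ ∧ t ∈ Φ₃.1) =
        Finset.univ.filter fun t => e₃ t ∈ (Finset.univ.filter fun y : Fin 5 × Bool => y.2 = false ∧ y.2 = decide (y.1 = 0 ∨ y.1 = 1)) := by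
      refine Finset.filter_congr fun t _ => ?_
      rw [hΦ₃ t, Finset.mem_filter, hneg t]
      simp
    rw [hfilter, card_filter_equiv_mem]
    decide

/-- **The Weil plane of the sixfold `(B × E, ι_B(i₃δ) × ι_E(δ))` is algebraic, GIVEN Markman's hyperbolic-sixfold theorem** — seat b09's
`DecicCurveFivefold.weilClassesOf_le_algebraicClasses_cmFivefold_prod_cmCurve_of_markmanSixfold` (Weil type `(3,3)`, discriminant from `k`)
fed with the type count of the `(2,3)`-reading. [cite: Markman2025SecantWeil, Thm 1.5.1] [cite: vanGeemen1994HodgeAV, 4.9–4.10] -/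
theorem weilClassesOf_sixfold_le_algebraicClasses_of_frameSD_of_markmanSixfold (hM6 : Markman2025_weilClasses_algebraic_hyperbolicSixfold)
    (h10 : Module.finrank ℚ (Kf i₂) = 10) (h2 : Module.finrank ℚ (Kf i₀) = 2) (i₃' : Kf i₀ →+* Kf i₂)
    {δ : 𝓞 (Kf i₀)} {d : ℕ} (hd : 0 < d) (hδ : ((δ : Kf i₀)) ^ 2 = -(d : Kf i₀))
    (hA : ∀ j, IsCMTypeRealisation (Φ j) (A j) (ι j) (θ j))
    (he₃_sign : ∀ t : Kf i₂ →+* ℂ, (e₃ t).2 = true ↔ t.comp i₃' = τ)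
    (hΦ₃ : ∀ t : Kf i₂ →+* ℂ, t ∈ (Φ 2).1 ↔ (e₃ t).2 = decide ((e₃ t).1 = 0 ∨ (e₃ t).1 = 1))
    (hΨ : ∀ σ : Kf i₀ →+* ℂ, σ ∈ (Φ 0).1 ↔ σ = τ) :
    weilClassesOf ((A 2).prod (A 0))
      (AbelianVariety.prodLift (AbelianVariety.fst (A 2) (A 0) ≫ ι 2 (RingOfIntegers.mapRingHom i₃' δ))
        (AbelianVariety.snd (A 2) (A 0) ≫ ι 0 δ)) 3 d ≤ algebraicClasses ((A 2).prod (A 0)).X 3 :=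
  DecicCurveFivefold.weilClassesOf_le_algebraicClasses_cmFivefold_prod_cmCurve_of_markmanSixfold hM6 h10 h2 i₃' (hA 2) (hA 0) hd hδ
    fun τ' => typeCount_sixfold_of_frameSD h2 he₃_sign hΦ₃ hΨ τ'

end Markman

end Summit.HodgeConjecture.CorCM.SexticDecicWeil

end
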